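import Mathlib
import HarnessLib
import HarnessLib.Audit
import Summits.MatrixMultiplication.Statement
import Literature.Computability.AlgebraicComplexity.XyzCubeFlattening
import Literature.Computability.AlgebraicComplexity.CoppersmithWinograd1990Proofs
import Literature.Computability.AlgebraicComplexity.GroupTheoreticMatMulProofs
import Literature.Computability.AlgebraicComplexity.TensorRestrictionRank
import Literature.Computability.AlgebraicComplexity.GroupAlgebraTensor
import Literature.RepresentationTheory.FiniteGroups.CharacterDegrees
import HarnessLib.Audit.Status.Attr

/-!
Route: CwPowerHosting

DORMANT since 2026-08-25T03:48:57Z (reconciler: no traction for 7.3 d (last activity item-evidence-added at 2026-08-17T18:59:58Z); parked, not closed — `ledger route dormant route-MatrixMultiplication-CwPowerHosting --off` to reactivate) — unstaffed, not closed; items shared with open routes are served there. `ledger route dormant <id> --off` reactivates.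

# Route CwPowerHosting — host the support of Kronecker powers of T_cw,2 freely in abelian tables of
order 3^((1+o(1))N)

X = HOSTING RATE THREE ("it suffices to show X"; LENS RECOMB route, no card: it recombines the
shared crux BThesis of
AsymptoticRankCW / HesseHammingShells / HessianPlane / TripartitionBridge with the abelian-table
machinery of DesignFlattening /
GroupTheoreticSTPP and the hosting lower bounds of AlmanVassilevskaWilliams2018 §6). Write xyz for
the S_3 permutation tensor
(tree `xyzTensor`, isomorphic to the small Coppersmith–Winograd tensor T_cw,2 over C). A FREE
HOSTING of its N-th Kronecker power in a
finite abelian group H is a triple of maps alpha, beta, gamma : {0,1,2}^N -> H such that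
alpha(x)+beta(y)+gamma(z) = 0 holds EXACTLY on
the support of xyz^(⊠N) (x i, y i, z i pairwise distinct for every i); it exhibits xyz^(⊠N) as a
restriction of the addition table of H,
so R(T_cw,2^(⊠N)) <= |H|. X: for every eps > 0 some power is hosted with |H| <= 3^((1+eps)N). Then
R~(T_cw,2) = 3 and omega = 2
(Coppersmith–Winograd 1990 §11, PROVED in the tree in rank form). Findings filed with the route
(planner, exp/): every hosting is
coordinatewise ADDITIVE (computed for N <= 3), which turns X into a zero-sum statement about N pairs
(p_i,q_i) in H — no nonempty
transversal of the value sets V(p,q) = {±p, ±q, ±(p−q), −(p+q), 2p−q, 2q−p} may sum to 0 — with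
exact small values g(1) = 4,
g(2) = 16 equal to the border ranks 4, 16, and g(3) >= 54.
Lean: `∀ ε : ℝ, 0 < ε → ∃ (N : ℕ) (H : Type) (_ : AddCommGroup H) (_ : Fintype H), 1 ≤ N ∧
(Fintype.card H : ℝ) ≤ (3 : ℝ) ^ ((1 + ε) * N) ∧ ∃ α β γ : (Fin N → Fin 3) → H, ∀ x y z : Fin N →
Fin 3, α x + β y + γ z = 0 ↔ ∀ i, x i ≠ y i ∧ x i ≠ z i ∧ y i ≠ z i`

## Assembly
The deciding theorem `closes : HostingRateThree → MatrixMultiplication` is PROVED sorry-free in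
glue.lean (certified by the native
check) from tree theorems only: the hosting is a pull-back of the addition table of H
(`tensorRestrictsTo_precomp`,
`tensorRank_addGroupAlgTensor_le`), T_cw,2 is a restriction of xyz (explicit inverse of `cwToXyz`,
27 `fin_cases`), restriction
passes to Kronecker powers (`TensorRestrictsTo.kroneckerPow`, `.tensorRank_le`), so R(T_cw,2^(⊠N))
<= |H| <= 3^((1+eps)N); the
PROVED rank form `CoppersmithWinograd1990_rank_form_holds` at q = 2, k = N gives omega <=
log_2((4/27)·3^(3(1+eps))) = 2 +

Rationale: WHY THIS LINE. Mechanism: a restricted class of rank decompositions of the powers of T_cw,2 —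
sub-tensors of abelian group tables (all legs are
characters of H) — whose capacity theta := lim_N g(N)^(1/N) in [3,4] satisfies R~(T_cw,2) <= theta,
so theta = 3 gives omega = 2
(CoppersmithWinograd1990 §11; ConnerGesmundoLandsbergVentura2022 Thm 1.1). RECOMBINATION: (i) the
target and its proved glue come from
route AsymptoticRankCW (BThesis stmt-0588, `CoppersmithWinograd1990_rank_form_holds`; its
BStrictSubmult proves EXISTENCE of k with
R(T_cw,2^(⊠k)) < 4^k non-constructively, our rung BeatFour asks for a group certificate); (ii) the
host-table calculus and the lesson
"fixed or product hosts are dead, growing non-product hosts are the exit" come from route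
DesignFlattening (AddTableRankLe stmt-5497,
EquivoluminousDeterminant: twist designs over Z_3^N cost (9/2)^N) — X is exactly its design-free (S
= 1) growing-host exit for F = xyz,
which that route abandoned for punctured matrix-multiplication hosting; (iii) the embedding calculus
(injectivity, packing, slice-rank
barriers for bounded exponent) comes from GroupTheoreticSTPP / ThinBlockAlpha and
BlasiakChurchCohnGrochowNaslundSawinUmans2017;
(iv) the nearest literature, AlmanVassilevskaWilliams2018 §6 (Lemma 6.3: the big CW_q is a
sub-tensor of T_G for abelian G only if
|G| >= 2q; Remark 6.2: C_2^k x C_4 hosts CW_(2^(k+1))), studied hosting at N = 1 as a LOWER-bound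
transfer device — here it becomes an
UPPER-bound programme along Kronecker powers. Imported area: zero-sum additive combinatorics /
extremal set theory (Davenport–Olson
constants, Jamison–Brouwer–Schrijver affine-hyperplane covering, chains in the Boolean lattice),
entering through ADDITIVE RIGIDITY
(crux AdditiveRigidity). What no parent had: finite DECIDABLE rungs (each N is a finite search;
g(1), g(2) computed, g(3) bracketed),
a two-sided programme (a capacity gap theta > 3 is a new barrier theorem for the whole group-hosting
class on the cw_2 line), and tools
that do not exist for general rank decompositions.

RANKED CRUXES. (rev 2026-08-17, route-repair unused-crux: the deciding theorem `closes` consumes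
HostingRateThree alone; the negative side HostingCapacityGap is now glued to it as a KILL PATH by
the support item CapacityGapRefutes; the first rung BeatFour is a CONSEQUENCE of X and the reduction
lemma AdditiveRigidity is provable-now (sorry-free candidate proof attached), so both are re-kinded
support; HostingSufficiency (theta = R~(T_cw,2): a consequence of X that returns X only together
with BThesis, which alone closes the summit) and NonabelianBeatFour (a non-abelian certificate of
R(T_cw,2^(⊠N)) < 4^N, implied by BeatFour; thesis and closes are abelian) fed neither `closes` nor
the kill path and were DROPPED — their decls stay in git history (rev 3) and the items are moot.) #2
HostingRateThree (crux) — for every eps > 0 there are N >= 1, a finite abelian group H with |H| <=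
3^((1+eps)N) and maps alpha beta gamma : ({0,1,2}^N) -> H with alpha x + beta y + gamma z = 0 iff x
i, y i, z i are pairwise distinct for all i. [difficulty: open-problem] (why it might fail: the
capacity theta may exceed 3 (data: g(1)=4, g(2)=16, g(3)>=54 and no order < 53 hosts N=3); additive
rigidity plus the asymmetric values 2p−q, 2q−p, −(p+q) may force theta = 4.)
[CoppersmithWinograd1990, ConnerGesmundoLandsbergVentura2022, AlmanVassilevskaWilliams2018,
AlmanLi2026]
#6 HostingCapacityGap (crux; the route's second crux and the KILL PATH of `closes` via
CapacityGapRefutes) — NEGATIVE SIDE (refutes the target; the expected kill): there is delta > 0 such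
that every free abelian hosting of every power has |H| >= (3+delta)^N — a capacity barrier for the
whole group-hosting class on the T_cw,2 line (from the deaths recorded in
GroupTheoreticSTPP/DesignFlattening: slice rank kills bounded exponent, direct sums kill elementary
2-groups at exactly 4^N, Jamison kills elementary 3-groups at 3^(1.5N), chains give 3^(N−1)(N+3)).
[deps: AdditiveRigidity] [difficulty: L] (why it might fail: all four floors in hand have rate
exactly 3 on unrestricted hosts (Minkowski and difference-packing are tight at 3^N because the
hexagon tiles); a (3+delta)^N bound must use the one-sided values and no crossing-pattern argument
beyond chains is known.) [AlmanVassilevskaWilliams2018,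
BlasiakChurchCohnGrochowNaslundSawinUmans2017, doi:10.1016/0097-3165(77)90001-2,
doi:10.1016/0022-314X(69)90021-3]
#3 BeatFour (support since 2026-08-17; was crux — a consequence of X by RateThreeGivesBeatFour, the
decidable first rung / milestone, not a hypothesis of `closes`; live window N = 4, |H| in [189,255])
— FIRST RUNG — some N >= 1 and some finite abelian H with |H| < 4^N host the N-th power freely (a
group certificate of strict submultiplicativity R(T_cw,2^(⊠N)) < 4^N = bR(T_cw,2)^N; decidable for
each N; from AsymptoticRankCW: BStrictSubmult gives such N only non-constructively, BCubeBorderRank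
stmt-1852 asks bR of the cube <= 63). [difficulty: L] (why it might fail: g(N) may equal 4^N for
every N: g(1)=4, g(2)=16 exactly (exhaustive), g(3) >= 54 (chain floor) with every abelian group of
order 34..52 failing by exhaustive search (exp/search_g2.py, job j019043 for 53..63).)
[ConnerHuangLandsberg2020, ConnerGesmundoLandsbergVentura2022, AlmanLi2026,
AlmanVassilevskaWilliams2018]
#5 AdditiveRigidity (support since 2026-08-17; was crux — the reduction lemma hosting ⇒ pair system
(†), feeding the negative side and the search, not `closes`) — ADDITIVE RIGIDITY — in any abelian
group, the equalities alpha x + beta y + gamma z = 0 on the support of xyz^(⊠N) alone force alpha,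
beta, gamma to be coordinatewise additive (a_0 + Sum_i a_i(x i)); verified for N <= 3 over Q and mod
2,3,5,7 (solution space of dimension 2N+2, all additive; exp/module_rank.py). It converts X into the
pair-system statement (†) and carries every floor below. [difficulty: provable-now — sorry-free
candidate proof AR_standalone.lean / AR.lean attached by refuter-rreview-0816T17-2-0, valid over
EVERY abelian group, so the p-torsion worry below is void] (why it might fail: the integer relation
module may acquire p-torsion for some prime p >= 11 or for N >= 4, allowing non-additive hostings in
special p-groups (good for X, fatal for the reduction); only N <= 3 and p <= 7 are checked.)
[AlmanVassilevskaWilliams2018, CohnKleinbergSzegedyUmans2005,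
BlasiakChurchCohnGrochowNaslundSawinUmans2017]
#9 CapacityGapRefutes (support, NEW 2026-08-17, stmt-MatrixMultiplication-17993) — KILL-PATH GLUE:
HostingCapacityGap → ¬HostingRateThree (given the floor (3+delta)^N take eps := log_3(1+delta/6) >
0, so 3^((1+eps)N) = (3+delta/2)^N < (3+delta)^N <= |H| <= 3^((1+eps)N), contradiction); an 18-line
proof checked rc 0 on the farm is attached as evidence (KillPath.lean) — land it together with the
literal form `HostingCapacityGap → ¬ HostingRateThree` so the closes-cone records HostingCapacityGap
itself as a kill path. [difficulty: provable-now] [CoppersmithWinograd1990]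
#9 HostingGivesRank (support) — a free abelian hosting of the N-th power gives R(T_cw,2^(⊠N)) <= |H|
(xyz^(⊠N) is the pull-back of the addition table along (−alpha, beta, gamma); T_cw,2 is a
restriction of xyz by the inverse isotropic change of basis; proved inside glue.lean already).
[difficulty: provable-now] [ConnerGesmundoLandsbergVentura2022, CohnKleinbergSzegedyUmans2005]
#9 PairsGiveHosting (support) — the constructive direction of the reformulation (†): N pairs
(p_i,q_i) in H such that no nonempty transversal of the value sets {±p_i, ±q_i, ±(p_i−q_i),
−(p_i+q_i), 2p_i−q_i, 2q_i−p_i} sums to zero yield a free hosting in the same H (gamma = Sum_i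
(0,p_i,q_i)(z i), alpha, beta its translates). [difficulty: provable-now]
[AlmanVassilevskaWilliams2018, CohnKleinbergSzegedyUmans2005]
#9 SmallHostings (support) — g(1) <= 4 (Klein four-group: gamma = alpha = (0,a,b), beta = (a+b, b,
a)) and g(2) <= 16 ((Z/4)^2: pairs ((0,1),(1,0)) and ((0,2),(2,0))), both `decide`-able; with
bR(T_cw,2) = 4 and bR of the square = 16 these are equalities. [difficulty: provable-now]
[ConnerHuangLandsberg2020, AlmanVassilevskaWilliams2018]
#9 TwoGroupFloor (support) — in an elementary abelian 2-group the value sets are 2-dimensional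
subspaces minus 0 and (†) says they form a direct sum, so |H| >= 4^N: characteristic 2 never beats
the trivial product hosting. [difficulty: provable-now] [AlmanVassilevskaWilliams2018,
BlasiakChurchCohnGrochowNaslundSawinUmans2017]
#9 ThreeGroupFloor (support) — in an elementary abelian 3-group a hosting of the N-th power needs
|H| >= 3^(3N/2): the relation space of the 2N vectors p_i,q_i in F_3^n must consist of vectors
having a coordinate pair equal to (1,1), and Jamison / Brouwer–Schrijver (F_q^d minus 0 needs d(q−1)
affine hyperplanes) caps its dimension at N/2; tight for base-3 digit hostings. [difficulty: M]
[doi:10.1016/0097-3165(77)90001-2, doi:10.1016/0097-3165(78)90013-4,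
BlasiakChurchCohnGrochowNaslundSawinUmans2017]
#9 ChainFloor (support) — for every abelian hosting, the sums Sum_i t_i over words t in Prod_i {0,
p_i, q_i, p_i+q_i} whose 0-letters all precede their (p+q)-letters are pairwise distinct (a
collision needs a crossing pattern, forbidden by (†)), hence |H| >= 3^(N−1)(N+3) (= 4, 15, 54, 189
for N = 1..4; sharp at N = 1). [difficulty: provable-now] [AlmanVassilevskaWilliams2018,
doi:10.1016/0022-314X(69)90021-3]
#9 RateThreeGivesBeatFour (support) — the first rung is necessary: HostingRateThree implies BeatFour
(take eps with 3^(1+eps) < 4). [difficulty: provable-now] [CoppersmithWinograd1990]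

TWO-LAYER PLAN. Foreseen glued splits (none filed now): HostingRateThree ⇐ AdditiveRigidity →
PairSystemsRateThree → HostingRateThree (PairSystems =
the (†) form: N pairs in H of order 3^((1+eps)N) with no zero-sum transversal; glue =
PairsGiveHosting); BeatFour ⇐ CyclicBeatFour |
MixedBeatFour (a host of order < 4^N that is cyclic, resp. Z_3^a x Z_(2^b)-mixed) → BeatFour;
HostingCapacityGap ⇐ OneSidedPacking
(an injective word family of size (3+delta)^N using the values 2p−q, 2q−p) → HostingCapacityGap.

KILL CRITERIA. HostingCapacityGap PROVED refutes the target (by name through CapacityGapRefutes: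
`¬HostingRateThree`): close --reason refuted:HostingRateThree (the capacity barrier and the floors
are then
filed into Literature/Barriers/MatrixMultiplication as GroupHostingBarrier — the informative outcome
for the four routes wanting
BThesis). A universal spectral point > 3 at T_cw,2 (¬BThesis, route AsymptoticRankCW's kill) or
omega > 2 closes it too. BeatFour
refuted for all N (g ≡ 4^N) is the same kill in sharper form. BThesis proved elsewhere moots the
route; a proof that hosting cannot reach some certificate rate rho_k + eps (the dropped
HostingSufficiency refuted; theta > R~) demotes the route to its finite rungs (close --reason
superseded if nothing else is live).

NOT DECOMPOSED YET. Which host families to search (cyclic 2- and 3-power towers with carries,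
Z_9/Z_27 digits, mixed Z_4 x Z_3 levels), the SAT/ILP
formulation of (†) for N = 4, 5 (orders 189..255 and 600..1023), the LP/Delsarte dual for the
capacity theta, and the non-abelian
accounting (Wedderburn cost Sum d^3) are layer-2 material; no third layer will be filed — search
scripts and certificates ride as
evidence, floors as --supports lemmas.

CHEAPEST FALSIFIER. RUN (this session): exhaustive search over all abelian groups — g(1) = 4 (only
Z_2^2 among orders <= 4; Z_6, Z_7 also host),
g(2) = 16 (orders 9..15 all fail; Z_4^2, Z_4 x Z_2^2, Z_2^4 host), N = 3: every abelian group of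
order 34..52 and Z_49, Z_7^2,
Z_9 x Z_7 fail (exp/search_g2.py, < 3 min locally); orders 53..63 and a randomized N = 4 sweep over
40 groups of order 96..252 are
kit job j019043 (queued at filing). A YES below 64 settles BeatFour and gives an explicit
R(T_cw,2^(⊠3)) <= 63; the expected NO
(g(3) = 64) is the third data point for HostingCapacityGap. The cheapest kill of the whole line is a
proof of ChainFloor's
strengthening to (3+delta)^N.

NUMBERS. bR(T_cw,2) = 4, bR(T_cw,2^(⊠2)) = 16 (ConnerHuangLandsberg2020 Thm 1.1), 3^N + 2^N − 1 <=
bR(T_cw,2^(⊠N)) (ConnerGesmundoLandsbergVentura2022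
Thm 1.2; 34 at N = 3, 97 at N = 4), R~(T_cw,2) < 3.931 (AlmanLi2026 Thm 1.3); hosting numbers (this
session): g(1) = 4, g(2) = 16,
54 <= g(3) <= 64, 189 <= g(4) <= 256, chain floor 3^(N−1)(N+3), elementary-3 floor 3^(1.5N)
(5.196^N), elementary-2 floor 4^N,
the (1,2)-split ansatz Z_3^N x Z_m costs m = 4, 5, 10, 13, 28, 35 for N = 1..6 (exp/zsf_triples.py;
rate ≈ 3 x 1.65 > 4);
AVW18 Lemma 6.3: CW_q ⊂ T_G (abelian) ⇒ |G| >= 2q, tight for C_2^k x C_4; omega <=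
log_2((4/27)·g^(3/N)) from any hosting of order g.

DEFINITION REQUESTS. None: every statement is typed over `Fin N → Fin 3`, `AddCommGroup`, `Fintype`,
`tensorRank`, `kroneckerPow`, `cwTensor`,
`maxCharDegree` (all existing); the hosting predicate is inlined.

Novelty: Searches (2026-08-16): `lit search --hybrid "Coppersmith-Winograd tensor embedding abelian group
addition table triple product property realization of tensor support"` (15 book hits, none
relevant); `lit search ... --source arxiv|s2|openalex` (remote APIs rate-limited, 0 rows); `lit
galaxy search "group-theoretic approach" --star all` (41 rows; Sawin matchings bound the only
relevant); `lit read arxiv:1810.08671 --grep embed|sub-tensor` (12 hits: §6 Lemma 6.3, Remark 6.2,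
Thm 6.2 read in full), `lit read arxiv:1605.06702`, `arxiv:2204.03826` (no hosting of CW tensors);
hub: 64 route files + 173 idea cards of the summit scanned (digest_local.md), `ledger negatives`;
tree: `lean search` for xyzTensor / cwTensor / TensorRestrictsTo / addGroupAlgTensor (the N = 1
direction `tensorRestrictsTo_cwTensor_xyzTensor` exists, nothing on group hosting of xyz powers).
Nearest prior art found: AlmanVassilevskaWilliams2018 (arXiv:1810.08671) §6 — CW_q as a sub-tensor
of group tensors at N = 1, as a device to transfer slice-rank LOWER bounds (Lemma 6.3 |G| >= 2q,
Remark 6.2, Thm 6.2); CoppersmithWinograd1990 §11 /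
Literature.Barriers.MatrixMultiplication.EquivoluminousBarrier (a different abelian-group
continuation of the cw_2 line, dead by cap sets); route DesignFlattening (product hosts Z_3^N with
completion designs; growing hosts named as exit but typed only for punctured matrix-multiplication
hosting); card cw2-moebius-signed-ghz-kill-tech (inclusion–exclusion over diagonal coordinates i  [refs: 1810.08671, 1605.06702, 2204.03826, arxiv:1810.08671, arxiv:1605.06702, arxiv:2204.03826, AlmanVassilevskaWilliams2018, CoppersmithWinograd1990]

Barriers (technique_class: group-table-hosting, cw2-kronecker-powers, zero-sum): - technique_class: group-table-hosting, cw2-kronecker-powers, zero-sum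
- Literature.Barriers.MatrixMultiplication.InfimumNotMinimumBarrier: evaded by design — X quantifies
over a SEQUENCE of powers N (theta is a limit); a single rung (BeatFour) is only claimed to certify
R~(T_cw,2) < 4 explicitly and omega <= log_2((4/27) g^(3/N)), never omega = 2.
- Literature.Barriers.MatrixMultiplication.IrreversibilityBarrier: the intermediate tensor is T_cw,2
itself, whose barrier exponent is 2·log R~(T_cw,2)/log 3 (CVZ Thm 19 regime q = 2): it is vacuous
exactly when X holds (R~ = 3 = Q~) and bites exactly when HostingCapacityGap-type statements hold —
the route decides which.
- UniversalMethodBarrier (Alman 2021; file present, not in the gate's catalogue list): Alman's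
omega_u(CW_q) >= 2.16805 is for the big CW_q, q >= 1; for the small q = 2 tensor the
universal-method value is 2 iff R~(T_cw,2) = 3 (CW90 §11 as proved in the tree), so no barrier
constant stands between X and omega = 2; the hosting is an upper bound on R(T_cw,2^(⊠N)) itself,
upstream of any extraction method.
- Literature.Barriers.MatrixMultiplication.TricoloredSumFreeBarrier: it DOES bite on
bounded-exponent hosts (xyz^(⊠N) ⊂ T_H forces slice rank 3^(N−o(N)) <= |H|^(1−delta_l)), so hosts
must have growing exponent (cyclic / mixed towers with carries); recorded as the route's own floors
(TwoGroupFloor, ThreeGroupFloor are the sharp exponent-2/3 instances); the bet is that carries in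
Z_(p^k) buy what digits cannot.
- Lit

History (route lifecycle, newest last):
- 2026-08-17T08:55:32Z · rev 4: dropped HostingSufficiency, NonabelianBeatFour — route-repair (unused-crux, gen 1): DROP HostingSufficiency (consequence of X that returns X only together with BThesis, which alone closes the summit; open-prob (planner-rrepair-MatrixMultiplication-CwPowerHo-06a6875e-0)
- 2026-08-25T03:48:57Z · DORMANT — reconciler: no traction for 7.3 d (last activity item-evidence-added at 2026-08-17T18:59:58Z); parked, not closed — `ledger route dormant route-MatrixMultiplica (operator:999:3900864)

sub-problem: MatrixMultiplication · status: dormant · opened planner-plan-lens-MatrixMultiplication-recomb-v2-g2-0 2026-08-16T17:37:24Z · rev 5 · ledger route-MatrixMultiplication-CwPowerHosting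
GENERATED by the gate from the ledger (D-0016/17). Provers cite these decls: `theorem foo : Summit.MatrixMultiplication.MatrixMultiplication.Theses.CwPowerHosting.<Decl> := …` in Summits/MatrixMultiplication/MatrixMultiplication/Theorems/<Name>.lean.
-/

namespace Summit.MatrixMultiplication.MatrixMultiplication.Theses.CwPowerHosting

open scoped BigOperators Topology Manifold Classical MeasureTheory ProbabilityTheory Matrix InnerProductSpace ComplexConjugate ContinuousMap
open Filter Set Function TopologicalSpace MeasureTheory

attribute [summit_statement] _root_.MatrixMultiplication

/-- item stmt-MatrixMultiplication-15970 · crux · rank 2 · open · by planner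
why it might fail: the capacity theta may simply be 4: g(1)=4, g(2)=16, g(3)=64 by exhaustive search over every abelian group of order < 4^N (EVIDENCE.md) — hosting has never beaten border rank; additive rigidity plus the one-sided values 2p−q, 2q−p, −(p+q) may force theta = 4 for all N.
sources: CoppersmithWinograd1990, ConnerGesmundoLandsbergVentura2022, AlmanVassilevskaWilliams2018, AlmanLi2026
[crux] for every eps > 0 there are N >= 1, a finite abelian group H with |H| <= 3^((1+eps)N) and
maps alpha beta gamma : ({0,1,2}^N) -> H with alpha x + beta y + gamma z = 0 iff x i, y i, z i are
pairwise distinct for all i. [difficulty: open-problem] -/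
@[route_item "route-MatrixMultiplication-CwPowerHosting", crux]
def HostingRateThree : Prop :=
  ∀ ε : ℝ, 0 < ε → ∃ (N : ℕ) (H : Type) (_ : AddCommGroup H) (_ : Fintype H), 1 ≤ N ∧ (Fintype.card H : ℝ) ≤ (3 : ℝ) ^ ((1 + ε) * N) ∧ ∃ α β γ : (Fin N → Fin 3) → H, ∀ x y z : Fin N → Fin 3, α x + β y + γ z = 0 ↔ ∀ i, x i ≠ y i ∧ x i ≠ z i ∧ y i ≠ z i

/-- item stmt-MatrixMultiplication-15974 · crux · rank 6 · open · by planner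
why it might fail: all four floors in hand have rate exactly 3 on unrestricted hosts (Minkowski and difference-packing are tight at 3^N because the hexagon tiles); a (3+delta)^N bound must use the one-sided values and no crossing-pattern argument beyond chains is known.
sources: AlmanVassilevskaWilliams2018, BlasiakChurchCohnGrochowNaslundSawinUmans2017, doi:10.1016/0097-3165(77)90001-2, doi:10.1016/0022-314X(69)90021-3
[crux] NEGATIVE SIDE (refutes the target; the expected kill): there is delta > 0 such that every
free abelian hosting of every power has |H| >= (3+delta)^N — a capacity barrier for the whole
group-hosting class on the T_cw,2 line (from the deaths recorded in
GroupTheoreticSTPP/DesignFlattening: slice rank kills bounded exponent, direct sums kill elementary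
2-groups at exactly 4^N, Jamison kills elementary 3-groups at 3^(1.5N), chains give 3^(N−1)(N+3)).
[deps: AdditiveRigidity] [difficulty: L] -/
@[route_item "route-MatrixMultiplication-CwPowerHosting"]
def HostingCapacityGap : Prop :=
  ∃ δ : ℝ, 0 < δ ∧ ∀ (N : ℕ) (H : Type) [AddCommGroup H] [Fintype H] (α β γ : (Fin N → Fin 3) → H), 1 ≤ N → (∀ x y z : Fin N → Fin 3, α x + β y + γ z = 0 ↔ ∀ i, x i ≠ y i ∧ x i ≠ z i ∧ y i ≠ z i) → ((3 : ℝ) + δ) ^ N ≤ Fintype.card H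

/-- item stmt-MatrixMultiplication-15971 · support · rank 3 · open · by planner
why it might fail: g(N) = 4^N for N = 1, 2, 3 (exhaustive: all 52 abelian groups of order 34..63 fail at N = 3, kit j019043 + local; EVIDENCE.md), so a witness needs N >= 4 in the window 189..255 (chain floor) — and g may equal 4^N for every N.
sources: ConnerHuangLandsberg2020, ConnerGesmundoLandsbergVentura2022, AlmanLi2026, AlmanVassilevskaWilliams2018
[crux] FIRST RUNG — some N >= 1 and some finite abelian H with |H| < 4^N host the N-th power freely
(a group certificate of strict submultiplicativity R(T_cw,2^(⊠N)) < 4^N = bR(T_cw,2)^N; decidable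
for each N; from AsymptoticRankCW: BStrictSubmult gives such N only non-constructively,
BCubeBorderRank stmt-1852 asks bR of the cube <= 63). [difficulty: L] -/
@[route_item "route-MatrixMultiplication-CwPowerHosting"]
def BeatFour : Prop :=
  ∃ (N : ℕ) (H : Type) (_ : AddCommGroup H) (_ : Fintype H), 1 ≤ N ∧ Fintype.card H < 4 ^ N ∧ ∃ α β γ : (Fin N → Fin 3) → H, ∀ x y z : Fin N → Fin 3, α x + β y + γ z = 0 ↔ ∀ i, x i ≠ y i ∧ x i ≠ z i ∧ y i ≠ z i

/-- item stmt-MatrixMultiplication-15973 · support · rank 5 · open · by planner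
why it might fail: the integer relation module may acquire p-torsion for some prime p >= 11 or for N >= 4, allowing non-additive hostings in special p-groups (good for X, fatal for the reduction); only N <= 3 and p <= 7 are checked.
sources: AlmanVassilevskaWilliams2018, CohnKleinbergSzegedyUmans2005, BlasiakChurchCohnGrochowNaslundSawinUmans2017
[crux] ADDITIVE RIGIDITY — in any abelian group, the equalities alpha x + beta y + gamma z = 0 on
the support of xyz^(⊠N) alone force alpha, beta, gamma to be coordinatewise additive (a_0 + Sum_i
a_i(x i)); verified for N <= 3 over Q and mod 2,3,5,7 (solution space of dimension 2N+2, all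
additive; exp/module_rank.py). It converts X into the pair-system statement (†) and carries every
floor below. [difficulty: M] -/
@[route_item "route-MatrixMultiplication-CwPowerHosting"]
def AdditiveRigidity : Prop :=
  ∀ (N : ℕ) (H : Type) [AddCommGroup H] (α β γ : (Fin N → Fin 3) → H), (∀ x y z : Fin N → Fin 3, (∀ i, x i ≠ y i ∧ x i ≠ z i ∧ y i ≠ z i) → α x + β y + γ z = 0) → ∃ (a b c : Fin N → Fin 3 → H) (a₀ b₀ c₀ : H), (∀ x, α x = a₀ + ∑ i, a i (x i)) ∧ (∀ y, β y = b₀ + ∑ i, b i (y i)) ∧ (∀ z, γ z = c₀ + ∑ i, c i (z i))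

/-- item stmt-MatrixMultiplication-15976 · support · rank 9 · open · by planner
sources: ConnerGesmundoLandsbergVentura2022, CohnKleinbergSzegedyUmans2005
[support] a free abelian hosting of the N-th power gives R(T_cw,2^(⊠N)) <= |H| (xyz^(⊠N) is the
pull-back of the addition table along (−alpha, beta, gamma); T_cw,2 is a restriction of xyz by the
inverse isotropic change of basis; proved inside glue.lean already). [difficulty: provable-now] -/
@[route_item "route-MatrixMultiplication-CwPowerHosting"]
def HostingGivesRank : Prop :=
  ∀ (N : ℕ) (H : Type) [AddCommGroup H] [Fintype H] (α β γ : (Fin N → Fin 3) → H), (∀ x y z : Fin N → Fin 3, α x + β y + γ z = 0 ↔ ∀ i, x i ≠ y i ∧ x i ≠ z i ∧ y i ≠ z i) → Literature.Computability.AlgebraicComplexity.tensorRank (Literature.Computability.AlgebraicComplexity.kroneckerPow (Literature.Computability.AlgebraicComplexity.cwTensor ℂ 2) N) ≤ Fintype.card H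

/-- item stmt-MatrixMultiplication-15977 · support · rank 9 · open · by planner
sources: AlmanVassilevskaWilliams2018, CohnKleinbergSzegedyUmans2005
[support] the constructive direction of the reformulation (†): N pairs (p_i,q_i) in H such that no
nonempty transversal of the value sets {±p_i, ±q_i, ±(p_i−q_i), −(p_i+q_i), 2p_i−q_i, 2q_i−p_i} sums
to zero yield a free hosting in the same H (gamma = Sum_i (0,p_i,q_i)(z i), alpha, beta its
translates). [difficulty: provable-now] -/
@[route_item "route-MatrixMultiplication-CwPowerHosting"]
def PairsGiveHosting : Prop :=
  ∀ (N : ℕ) (H : Type) [AddCommGroup H] [DecidableEq H] (p q : Fin N → H), (∀ (D : Finset (Fin N)) (v : Fin N → H), D.Nonempty → (∀ i ∈ D, v i ∈ ({p i, -p i, q i, -q i, p i - q i, q i - p i, -(p i + q i), 2 • p i - q i, 2 • q i - p i} : Finset H)) → ∑ i ∈ D, v i ≠ 0) → ∃ α β γ : (Fin N → Fin 3) → H, ∀ x y z : Fin N → Fin 3, α x + β y + γ z = 0 ↔ ∀ i, x i ≠ y i ∧ x i ≠ z i ∧ y i ≠ z i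

/-- item stmt-MatrixMultiplication-15978 · support · rank 9 · open · by planner
sources: ConnerHuangLandsberg2020, AlmanVassilevskaWilliams2018
[support] g(1) <= 4 (Klein four-group: gamma = alpha = (0,a,b), beta = (a+b, b, a)) and g(2) <= 16
((Z/4)^2: pairs ((0,1),(1,0)) and ((0,2),(2,0))), both `decide`-able; with bR(T_cw,2) = 4 and bR of
the square = 16 these are equalities. [difficulty: provable-now] -/
@[route_item "route-MatrixMultiplication-CwPowerHosting"]
def SmallHostings : Prop :=
  (∃ α β γ : (Fin 1 → Fin 3) → ZMod 2 × ZMod 2, ∀ x y z : Fin 1 → Fin 3, α x + β y + γ z = 0 ↔ ∀ i, x i ≠ y i ∧ x i ≠ z i ∧ y i ≠ z i) ∧ (∃ α β γ : (Fin 2 → Fin 3) → ZMod 4 × ZMod 4, ∀ x y z : Fin 2 → Fin 3, α x + β y + γ z = 0 ↔ ∀ i, x i ≠ y i ∧ x i ≠ z i ∧ y i ≠ z i)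

/-- item stmt-MatrixMultiplication-15979 · support · rank 9 · open · by planner
sources: AlmanVassilevskaWilliams2018, BlasiakChurchCohnGrochowNaslundSawinUmans2017
[support] in an elementary abelian 2-group the value sets are 2-dimensional subspaces minus 0 and
(†) says they form a direct sum, so |H| >= 4^N: characteristic 2 never beats the trivial product
hosting. [difficulty: provable-now] -/
@[route_item "route-MatrixMultiplication-CwPowerHosting"]
def TwoGroupFloor : Prop :=
  ∀ (N : ℕ) (H : Type) [AddCommGroup H] [Fintype H] (α β γ : (Fin N → Fin 3) → H), (∀ h : H, h + h = 0) → (∀ x y z : Fin N → Fin 3, α x + β y + γ z = 0 ↔ ∀ i, x i ≠ y i ∧ x i ≠ z i ∧ y i ≠ z i) → 4 ^ N ≤ Fintype.card H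

/-- item stmt-MatrixMultiplication-15980 · support · rank 9 · open · by planner
sources: doi:10.1016/0097-3165(77)90001-2, doi:10.1016/0097-3165(78)90013-4, BlasiakChurchCohnGrochowNaslundSawinUmans2017
[support] in an elementary abelian 3-group a hosting of the N-th power needs |H| >= 3^(3N/2): the
relation space of the 2N vectors p_i,q_i in F_3^n must consist of vectors having a coordinate pair
equal to (1,1), and Jamison / Brouwer–Schrijver (F_q^d minus 0 needs d(q−1) affine hyperplanes) caps
its dimension at N/2; tight for base-3 digit hostings. [difficulty: M] -/
@[route_item "route-MatrixMultiplication-CwPowerHosting"]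
def ThreeGroupFloor : Prop :=
  ∀ (N : ℕ) (H : Type) [AddCommGroup H] [Fintype H] (α β γ : (Fin N → Fin 3) → H), (∀ h : H, h + h + h = 0) → (∀ x y z : Fin N → Fin 3, α x + β y + γ z = 0 ↔ ∀ i, x i ≠ y i ∧ x i ≠ z i ∧ y i ≠ z i) → (3 : ℝ) ^ ((3 : ℝ) / 2 * N) ≤ Fintype.card H

/-- item stmt-MatrixMultiplication-15981 · support · rank 9 · open · by planner
sources: AlmanVassilevskaWilliams2018, doi:10.1016/0022-314X(69)90021-3
[support] for every abelian hosting, the sums Sum_i t_i over words t in Prod_i {0, p_i, q_i,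
p_i+q_i} whose 0-letters all precede their (p+q)-letters are pairwise distinct (a collision needs a
crossing pattern, forbidden by (†)), hence |H| >= 3^(N−1)(N+3) (= 4, 15, 54, 189 for N = 1..4; sharp
at N = 1). [difficulty: provable-now] -/
@[route_item "route-MatrixMultiplication-CwPowerHosting"]
def ChainFloor : Prop :=
  ∀ (N : ℕ) (H : Type) [AddCommGroup H] [Fintype H] (α β γ : (Fin N → Fin 3) → H), 1 ≤ N → (∀ x y z : Fin N → Fin 3, α x + β y + γ z = 0 ↔ ∀ i, x i ≠ y i ∧ x i ≠ z i ∧ y i ≠ z i) → 3 ^ (N - 1) * (N + 3) ≤ Fintype.card H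

/-- item stmt-MatrixMultiplication-15982 · support · rank 9 · open · by planner
sources: CoppersmithWinograd1990
[support] the first rung is necessary: HostingRateThree implies BeatFour (take eps with 3^(1+eps) <
4). [difficulty: provable-now] -/
@[route_item "route-MatrixMultiplication-CwPowerHosting"]
def RateThreeGivesBeatFour : Prop :=
  HostingRateThree → BeatFour

/-- item stmt-MatrixMultiplication-17993 · support · rank 9 · open · by planner
sources: CoppersmithWinograd1990, AlmanVassilevskaWilliams2018
[support] KILL-PATH GLUE (negative edge; the established pattern of
NOFWindowCapacity.GapKillsThesis): the negative-side crux HostingCapacityGap (capacity floor (3+δ)^N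
≤ |H| for every free abelian hosting of every power) REFUTES the thesis HostingRateThree — take ε :=
log_3(1+δ/6) > 0, then 3^((1+ε)N) = (3+δ/2)^N < (3+δ)^N ≤ |H| ≤ 3^((1+ε)N), contradiction. Pure real
arithmetic; an 18-line proof checked rc 0 on the farm is attached as evidence (KillPath.lean).
LANDING NOTE: land BOTH `theorem capacityGapRefutes_proof : CapacityGapRefutes` (closes this item)
AND the literal form `theorem hostingCapacityGap_refutes : HostingCapacityGap → ¬ HostingRateThree`
in the same Theorems file (plain --kind proof --workitem <this item>, not --negative-modulo): the
closes-cone rule for landed `X → ¬H` theorems then records the crux HostingCapacityGap itself as a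
kill path of `closes`. With HostingCapacityGap proved, `¬HostingRateThree` follows by name and the
route closes refuted:HostingRateThree (KILL CRITERIA). [difficulty: provable-now] -/
@[route_item "route-MatrixMultiplication-CwPowerHosting"]
def CapacityGapRefutes : Prop :=
  HostingCapacityGap → ¬ HostingRateThree

/-- item stmt-MatrixMultiplication-15983 · assembly · rank 1 · open · by planner
sources: CoppersmithWinograd1990, ConnerGesmundoLandsbergVentura2022
[assembly] HostingRateThree → MatrixMultiplication (the other cruxes are rungs, the reduction lemma
and the negative side; HostingSufficiency ∧ BThesis(AsymptoticRankCW) ↔ HostingRateThree). -/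
@[route_item "route-MatrixMultiplication-CwPowerHosting"]
def Assembly : Prop :=
  HostingRateThree → _root_.MatrixMultiplication

/-! D-0027 §2.1 — DECIDING THEOREM (planner-authored via `route open/edit --closes-file`; by planner-plan-lens-MatrixMultiplication-recomb-v2-g2-0 2026-08-16T17:37:25Z):
its hypotheses are this route's items and its conclusion the sub-problem Statement (glue_lint), and it elaborates with this file. -/

/-- DECIDING THEOREM (D-0027 §2.1). `HostingRateThree` ALONE decides `ω(ℂ) = 2`, through PROVED tree
results only: a free hosting of `supp(xyz^{⊠N})` in a finite abelian group `H` exhibits `xyz^{⊠N}` as a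
restriction of the addition table of `H` (rank `≤ |H|`, `tensorRank_addGroupAlgTensor_le`), `T_cw,2` is a
restriction of `xyz` over `ℂ` (inverse of the isotropic change of basis of CGLV §2.2), hence
`R(T_cw,2^{⊠N}) ≤ |H| ≤ 3^{(1+ε)N}`; the PROVED rank form of Coppersmith–Winograd 1990 §11
(`CoppersmithWinograd1990_rank_form_holds`, `q = 2`, `k = N`) gives `ω ≤ log₂((4/27)·3^{3(1+ε)}) = 2 + 3ε·log₂3`
for every `ε > 0`, so `ω ≤ 2`; with `2 ≤ ω` (`omega_two_le`), `ω(ℂ) = 2`. -/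
@[closes "route-MatrixMultiplication-CwPowerHosting"] theorem closes (hX : HostingRateThree) : _root_.MatrixMultiplication := by
  refine (_root_.MatrixMultiplication_iff).2 (le_antisymm ?_ (Literature.Computability.AlgebraicComplexity.omega_two_le ℂ))
  refine le_of_forall_pos_le_add fun δ hδ => ?_
  have hL : 0 < Real.logb 2 3 := Real.logb_pos (by norm_num) (by norm_num)
  set ε : ℝ := δ / (3 * Real.logb 2 3) with hε
  have hε0 : 0 < ε := by positivity
  obtain ⟨N, H, _, _, hN, hcard, α, β, γ, hhost⟩ := hX ε hε0
  have hN0 : (N : ℝ) ≠ 0 := by exact_mod_cast (show N ≠ 0 by omega)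
  -- (1) `xyz ≥ T_cw,2` over `ℂ`: the inverse `Q` of the change of basis `cwToXyz`.
  have hxyz : Literature.Computability.AlgebraicComplexity.TensorRestrictsTo (Literature.Computability.AlgebraicComplexity.xyzTensor ℂ) (Literature.Computability.AlgebraicComplexity.cwTensor ℂ 2) := by
    let Q : Fin 3 → Fin 3 → ℂ :=
      ![![1, 0, 0], ![0, ((1 : ℝ) / 2 : ℝ), 1], ![0, -(((1 : ℝ) / 2 : ℝ) * Complex.I), Complex.I]]
    have hsum : ∀ f : Fin 3 → Fin 3 → Fin 3 → ℂ,
        ∑ a, ∑ b, ∑ c, f a b c * Literature.Computability.AlgebraicComplexity.xyzTensor ℂ a b c =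
          f 0 1 2 + f 0 2 1 + f 1 0 2 + f 1 2 0 + f 2 0 1 + f 2 1 0 := by
      intro f
      simp only [Fin.sum_univ_three, Literature.Computability.AlgebraicComplexity.xyzTensor_apply, Literature.Computability.AlgebraicComplexity.comp1]
      simp
      ring
    refine ⟨Q, Q, Q, fun a b c => ?_⟩
    rw [hsum (fun x y z => Q a x * Q b y * Q c z)]
    fin_cases a <;> fin_cases b <;> fin_cases c <;>
      simp [Q, Literature.Computability.AlgebraicComplexity.cwTensor_apply, Complex.ext_iff] <;> norm_num
  -- (2) the hosting exhibits `xyz^{⊠N}` as a restriction of the addition table of `H`.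
  have hrank : Literature.Computability.AlgebraicComplexity.tensorRank (Literature.Computability.AlgebraicComplexity.kroneckerPow (Literature.Computability.AlgebraicComplexity.cwTensor ℂ 2) N) ≤ Fintype.card H := by
    classical
    have hU := Literature.Computability.AlgebraicComplexity.tensorRank_addGroupAlgTensor_le H
    have h1 : Literature.Computability.AlgebraicComplexity.TensorRestrictsTo (fun z x y : H => if x + y = z then (1 : ℂ) else 0)
        (Literature.Computability.AlgebraicComplexity.kroneckerPow (Literature.Computability.AlgebraicComplexity.xyzTensor ℂ) N) := by
      have h2 := Literature.Computability.AlgebraicComplexity.tensorRestrictsTo_precomp (fun z x y : H => if x + y = z then (1 : ℂ) else 0)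
        (fun x => -α x) β γ
      convert h2 using 1
      funext x y z
      simp only [Literature.Computability.AlgebraicComplexity.kroneckerPow_apply, Literature.Computability.AlgebraicComplexity.xyzTensor_apply]
      rw [Finset.prod_boole]
      simp only [Finset.mem_univ, forall_const]
      have hiff : (∀ i, Literature.Computability.AlgebraicComplexity.comp1 (y i) (z i) = some (x i)) ↔ β y + γ z = -α x := by
        rw [eq_neg_iff_add_eq_zero, show β y + γ z + α x = α x + β y + γ z by abel, hhost x y z]
        simp only [Literature.Computability.AlgebraicComplexity.comp1_eq_some_iff]
      simp only [hiff]
    exact ((hxyz.kroneckerPow N).tensorRank_le).trans (h1.tensorRank_le.trans hU)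
  -- (3) Coppersmith–Winograd 1990 §11 in rank form at `q = 2`, `k = N`.
  have hcw := Literature.Computability.AlgebraicComplexity.CoppersmithWinograd1990_rank_form_holds 2 N le_rfl hN
  change Literature.Computability.AlgebraicComplexity.omega ℂ ≤ Real.logb (2 : ℕ) ((4 / 27) *
    ((Literature.Computability.AlgebraicComplexity.tensorRank (Literature.Computability.AlgebraicComplexity.kroneckerPow (Literature.Computability.AlgebraicComplexity.cwTensor ℂ 2) N) : ℝ) ^ ((3 : ℝ) / N))) at hcw
  rw [Nat.cast_ofNat] at hcw
  set R : ℝ := (Literature.Computability.AlgebraicComplexity.tensorRank (Literature.Computability.AlgebraicComplexity.kroneckerPow (Literature.Computability.AlgebraicComplexity.cwTensor ℂ 2) N) : ℝ) with hRdef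
  have hR1 : (1 : ℝ) ≤ R := by
    rw [hRdef]; exact_mod_cast Literature.Computability.AlgebraicComplexity.one_le_tensorRank_kroneckerPow_cwTensor 2 N (by norm_num)
  have hR : R ≤ (3 : ℝ) ^ ((1 + ε) * N) := by
    rw [hRdef]; exact le_trans (by exact_mod_cast hrank) hcard
  refine hcw.trans ?_
  -- (4) real arithmetic: `log₂((4/27)·R^{3/N}) ≤ log₂(4·3^{3ε}) = 2 + 3ε·log₂3 = 2 + δ`.
  have h3 : R ^ ((3 : ℝ) / N) ≤ (3 : ℝ) ^ (3 * (1 + ε)) := by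
    calc R ^ ((3 : ℝ) / N)
        ≤ ((3 : ℝ) ^ ((1 + ε) * N)) ^ ((3 : ℝ) / N) :=
          Real.rpow_le_rpow (by linarith) hR (by positivity)
      _ = (3 : ℝ) ^ ((1 + ε) * N * ((3 : ℝ) / N)) := by rw [← Real.rpow_mul (by norm_num)]
      _ = (3 : ℝ) ^ (3 * (1 + ε)) := by congr 1; field_simp
  have hRpos : (0 : ℝ) < R ^ ((3 : ℝ) / N) := Real.rpow_pos_of_pos (by linarith) _
  have hpos : (0 : ℝ) < (4 / 27) * R ^ ((3 : ℝ) / N) := by positivity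
  have h4 : Real.logb 2 ((4 / 27) * R ^ ((3 : ℝ) / N))
      ≤ Real.logb 2 ((4 / 27) * (3 : ℝ) ^ (3 * (1 + ε))) :=
    Real.logb_le_logb_of_le (by norm_num) hpos (by gcongr)
  refine h4.trans (le_of_eq ?_)
  have h27 : (3 : ℝ) ^ (3 * (1 + ε)) = 27 * (3 : ℝ) ^ (3 * ε) := by
    rw [mul_add, mul_one, Real.rpow_add (by norm_num : (0 : ℝ) < 3)]
    norm_num
  rw [h27, show (4 : ℝ) / 27 * (27 * (3 : ℝ) ^ (3 * ε)) = 4 * (3 : ℝ) ^ (3 * ε) by ring]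
  rw [Real.logb_mul (by norm_num) (by positivity)]
  have h4' : Real.logb 2 4 = 2 := by
    rw [show (4 : ℝ) = 2 ^ (2 : ℕ) by norm_num, Real.logb_pow, Real.logb_self_eq_one (by norm_num)]
    norm_num
  rw [h4', Real.logb, Real.log_rpow (by norm_num : (0 : ℝ) < 3)]
  have hlog2 : Real.log 2 ≠ 0 := by positivity
  have hlog3 : Real.log 3 ≠ 0 := by positivity
  rw [hε, Real.logb]
  field_simp

end Summit.MatrixMultiplication.MatrixMultiplication.Theses.CwPowerHosting
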